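import Summits.ValiantsHypothesis.ValiantsHypothesis.Theorems.KPlusLogSqLawTropicalBToeplitzConjectureT

/-!
# Route `KPlusLogSqLaw`, crux `TropicalB` — Toeplitz sector: the admissible set of Conjecture T is INESSENTIAL

HONEST FRAMING.  Helper toward the registered stubs `stub_tropThin` / `stub_tropFat` of
`Cruxes/TropicalB/Lines/birth.lean` (crux `Summit.ValiantsHypothesis.ValiantsHypothesis.Theses.KPlusLogSqLaw.TropicalB`,
ledger item `stmt-ValiantsHypothesis-19771`, route `KPlusLogSqLaw`; cell `pub-symmetroid`, seat `val-sym-trop-p3`,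
2026-08-26).  A SIMPLIFICATION of the cell's Conjecture T count (OPEN): the hypothesis of the tree's Toeplitz reduction,
`Toeplitz.LinearInstanceBound m Φ` («`Φ_Toep(m) ≤ Φ`», p453677 / p429098), quantifies over an ADMISSIBLE SET `P` of
displacements (competitors are the permutations all of whose displacements lie in `P`).  The set is inessential: replacing
the intercept `α` by `−M` OFF `P`, with `M` large against every value in play (`M = 2·m·A + 1`, `A` the sum of all
`|θ'_k ψ δ| + |α δ|` over the chain's slopes and the displacement range `[−m, m]`), every chain member — which uses only
displacements in `P`, where the intercepts are unchanged — stays the unique maximiser among ALL permutations: an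
inadmissible competitor pays at least `M` at one position and gains at most `m·A` elsewhere.  Hence

* `linearInstanceBound_iff_free : LinearInstanceBound m Φ ↔ FreeInstanceBound m Φ`, where `FreeInstanceBound` is the
  same count with NO admissible set (all permutations compete) — the located datum O4 of the predecessor generation
  («no admissible-set restriction beats P = all at m ≤ 6», 614 masks) as a theorem for every `m`;
* the fixed-slope form `fixedSlopeInstanceBound_iff_free` (the construction keeps `ψ`), so `ConjectureQ` / `ConjectureR`
  may also be read without admissible sets;
* restatements `conjectureTLinear_iff_free`, `conjectureTPoly_iff_free`.

So Conjecture T is exactly the plane-shadow question for the displacement-profile polytope `conv{N(σ) : σ ∈ S_m}` (with the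
uniqueness proviso), with no side family of polytopes indexed by `P`.  Conjecture T stays OPEN; nothing here bears on
`TropicalB` for general designs, `WeakLifting`, `KPlusLogSqLaw`, `MatrixDescartes` or `VP ≠ VNP`.

References: folklore (big-M penalisation of forbidden assignments).
-/

set_option linter.dupNamespace false
set_option autoImplicit false

namespace Summit.ValiantsHypothesis.ValiantsHypothesis.Theorems.KPlusLogSqLaw.Toeplitz

open Summit.ValiantsHypothesis.ValiantsHypothesis.Theorems.KPlusLogSqLaw
open scoped BigOperators
open Finset

/-! ## The counts without an admissible set -/

/-- **«`Φ_Toep(m) ≤ Φ`» WITHOUT an admissible set**: every linear Toeplitz instance `(ψ, α)` of size `m` has at most `Φ`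
pairwise distinct permutations `τ₀ … τ_N`, `τ_k` the UNIQUE maximiser among ALL permutations of
`Σ_b (θ'_k·ψ + α)(τ b − b)` at strictly increasing integer slopes `θ'`. -/
def FreeInstanceBound (m Φ : ℕ) : Prop :=
  ∀ (ψ α : ℤ → ℤ) (N : ℕ) (θ' : Fin (N + 1) → ℤ) (τ : Fin (N + 1) → Equiv.Perm (Fin m)),
    StrictMono θ' → Function.Injective τ →
    (∀ k (σ' : Equiv.Perm (Fin m)), σ' ≠ τ k →
      ∑ b, (θ' k * ψ ((σ' b : ℤ) - (b : ℤ)) + α ((σ' b : ℤ) - (b : ℤ))) <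
        ∑ b, (θ' k * ψ ((τ k b : ℤ) - (b : ℤ)) + α ((τ k b : ℤ) - (b : ℤ)))) →
    N + 1 ≤ Φ

/-- The same count with the slope function `ψ` FIXED and no admissible set. -/
def FixedSlopeFreeInstanceBound (m : ℕ) (ψ : ℤ → ℤ) (Φ : ℕ) : Prop :=
  ∀ (α : ℤ → ℤ) (N : ℕ) (θ' : Fin (N + 1) → ℤ) (τ : Fin (N + 1) → Equiv.Perm (Fin m)),
    StrictMono θ' → Function.Injective τ →
    (∀ k (σ' : Equiv.Perm (Fin m)), σ' ≠ τ k →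
      ∑ b, (θ' k * ψ ((σ' b : ℤ) - (b : ℤ)) + α ((σ' b : ℤ) - (b : ℤ))) <
        ∑ b, (θ' k * ψ ((τ k b : ℤ) - (b : ℤ)) + α ((τ k b : ℤ) - (b : ℤ)))) →
    N + 1 ≤ Φ

/-- the free count is the conjunction of its fixed-slope classes. -/
theorem freeInstanceBound_iff_fixedSlope (m Φ : ℕ) :
    FreeInstanceBound m Φ ↔ ∀ ψ : ℤ → ℤ, FixedSlopeFreeInstanceBound m ψ Φ :=
  ⟨fun h ψ α N θ' τ hθ hτ hopt => h ψ α N θ' τ hθ hτ hopt,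
    fun h ψ α N θ' τ hθ hτ hopt => h ψ α N θ' τ hθ hτ hopt⟩

/-! ## Big-M penalisation: a chain for `(ψ, α, P)` is a chain for `(ψ, α', all)` -/

section BigM

variable {m : ℕ}

/-- displacements of permutations of `Fin m` lie in `[−m, m]`. [folklore] -/
private theorem displ_mem_Icc (σ : Equiv.Perm (Fin m)) (b : Fin m) :
    (σ b : ℤ) - (b : ℤ) ∈ Finset.Icc (-(m : ℤ)) m := by
  have h1 := (σ b).isLt
  have h2 := b.isLt
  rw [Finset.mem_Icc]
  constructor <;> omega

/-- **Big-M penalisation.**  Given slopes `ψ`, intercepts `α`, an admissible set `P`, finitely many slopes `θ'_k` and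
permutations `τ_k` using only admissible displacements, each the unique maximiser among the ADMISSIBLE permutations at
`θ'_k`: with `α' δ = α δ` on `P` and `α' δ = −(2·m·A + 1)` off `P` (`A = Σ_k Σ_{δ ∈ [−m,m]} (|θ'_k ψ δ| + |α δ|)`), each `τ_k`
is the unique maximiser among ALL permutations for `(ψ, α')` at `θ'_k`. [folklore] -/
theorem exists_free_intercepts (ψ α : ℤ → ℤ) (P : ℤ → Prop) (N : ℕ) (θ' : Fin (N + 1) → ℤ)
    (τ : Fin (N + 1) → Equiv.Perm (Fin m)) (hP : ∀ k b, P ((τ k b : ℤ) - (b : ℤ)))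
    (hopt : ∀ k (σ' : Equiv.Perm (Fin m)), σ' ≠ τ k → (∀ b, P ((σ' b : ℤ) - (b : ℤ))) →
      ∑ b, (θ' k * ψ ((σ' b : ℤ) - (b : ℤ)) + α ((σ' b : ℤ) - (b : ℤ))) <
        ∑ b, (θ' k * ψ ((τ k b : ℤ) - (b : ℤ)) + α ((τ k b : ℤ) - (b : ℤ)))) :
    ∃ α' : ℤ → ℤ, (∀ δ, P δ → α' δ = α δ) ∧
      ∀ k (σ' : Equiv.Perm (Fin m)), σ' ≠ τ k →
        ∑ b, (θ' k * ψ ((σ' b : ℤ) - (b : ℤ)) + α' ((σ' b : ℤ) - (b : ℤ))) <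
          ∑ b, (θ' k * ψ ((τ k b : ℤ) - (b : ℤ)) + α' ((τ k b : ℤ) - (b : ℤ))) := by
  classical
  -- the uniform bound `A` on every value in play
  set A : ℤ := ∑ k : Fin (N + 1), ∑ δ ∈ Finset.Icc (-(m : ℤ)) m, (|θ' k * ψ δ| + |α δ|) with hA
  have hA_nonneg : 0 ≤ A := by
    rw [hA]
    exact sum_nonneg fun k _ => sum_nonneg fun δ _ => by positivity
  have hle_A : ∀ (k : Fin (N + 1)) (δ : ℤ), δ ∈ Finset.Icc (-(m : ℤ)) m → |θ' k * ψ δ| + |α δ| ≤ A := by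
    intro k δ hδ
    rw [hA]
    calc |θ' k * ψ δ| + |α δ| ≤ ∑ δ' ∈ Finset.Icc (-(m : ℤ)) m, (|θ' k * ψ δ'| + |α δ'|) :=
          single_le_sum (f := fun δ' => |θ' k * ψ δ'| + |α δ'|) (fun δ' _ => by positivity) hδ
      _ ≤ ∑ k' : Fin (N + 1), ∑ δ' ∈ Finset.Icc (-(m : ℤ)) m, (|θ' k' * ψ δ'| + |α δ'|) :=
          single_le_sum (f := fun k' => ∑ δ' ∈ Finset.Icc (-(m : ℤ)) m, (|θ' k' * ψ δ'| + |α δ'|))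
            (fun k' _ => sum_nonneg fun δ' _ => by positivity) (mem_univ k)
  set M : ℤ := 2 * m * A + 1 with hM
  refine ⟨fun δ => if P δ then α δ else -M, fun δ hδ => by simp [hδ], fun k σ' hσ' => ?_⟩
  -- the chain member's value is unchanged (all its displacements are admissible)
  have hτval : ∑ b, (θ' k * ψ ((τ k b : ℤ) - (b : ℤ)) + (if P ((τ k b : ℤ) - (b : ℤ)) then α ((τ k b : ℤ) - (b : ℤ)) else -M))
      = ∑ b, (θ' k * ψ ((τ k b : ℤ) - (b : ℤ)) + α ((τ k b : ℤ) - (b : ℤ))) :=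
    sum_congr rfl fun b _ => by rw [if_pos (hP k b)]
  rw [hτval]
  by_cases hall : ∀ b, P ((σ' b : ℤ) - (b : ℤ))
  · -- admissible competitor: its value is unchanged too, and the hypothesis applies
    have hσval : ∑ b, (θ' k * ψ ((σ' b : ℤ) - (b : ℤ)) + (if P ((σ' b : ℤ) - (b : ℤ)) then α ((σ' b : ℤ) - (b : ℤ)) else -M))
        = ∑ b, (θ' k * ψ ((σ' b : ℤ) - (b : ℤ)) + α ((σ' b : ℤ) - (b : ℤ))) :=
      sum_congr rfl fun b _ => by rw [if_pos (hall b)]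
    rw [hσval]
    exact hopt k σ' hσ' hall
  · -- inadmissible competitor: one position pays `M`
    push Not at hall
    obtain ⟨b₀, hb₀⟩ := hall
    -- every term of the competitor is at most `A`, the bad one at most `A − M`
    have hterm : ∀ b, θ' k * ψ ((σ' b : ℤ) - (b : ℤ)) +
        (if P ((σ' b : ℤ) - (b : ℤ)) then α ((σ' b : ℤ) - (b : ℤ)) else -M) ≤
        A - (if b = b₀ then M else 0) := by
      intro b
      have hb := hle_A k _ (displ_mem_Icc σ' b)
      have h1 : θ' k * ψ ((σ' b : ℤ) - (b : ℤ)) ≤ |θ' k * ψ ((σ' b : ℤ) - (b : ℤ))| := le_abs_self _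
      have h2 : α ((σ' b : ℤ) - (b : ℤ)) ≤ |α ((σ' b : ℤ) - (b : ℤ))| := le_abs_self _
      have h3 : 0 ≤ |α ((σ' b : ℤ) - (b : ℤ))| := abs_nonneg _
      by_cases hb0 : b = b₀
      · subst hb0
        rw [if_neg hb₀, if_pos rfl]
        linarith
      · rw [if_neg hb0]
        split_ifs with hPb
        · linarith
        · have : (0 : ℤ) ≤ M := by rw [hM]; positivity
          linarith
    have hσle : ∑ b, (θ' k * ψ ((σ' b : ℤ) - (b : ℤ)) +
        (if P ((σ' b : ℤ) - (b : ℤ)) then α ((σ' b : ℤ) - (b : ℤ)) else -M)) ≤ m * A - M := by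
      calc ∑ b, (θ' k * ψ ((σ' b : ℤ) - (b : ℤ)) +
            (if P ((σ' b : ℤ) - (b : ℤ)) then α ((σ' b : ℤ) - (b : ℤ)) else -M))
          ≤ ∑ b : Fin m, (A - (if b = b₀ then M else 0)) := sum_le_sum fun b _ => hterm b
        _ = m * A - M := by
            rw [sum_sub_distrib, sum_const, card_univ, Fintype.card_fin, sum_ite_eq' univ b₀, if_pos (mem_univ _)]
            simp
    -- every term of the chain member is at least `−A`
    have hτge : -(m * A) ≤ ∑ b, (θ' k * ψ ((τ k b : ℤ) - (b : ℤ)) + α ((τ k b : ℤ) - (b : ℤ))) := by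
      have hterm' : ∀ b, -A ≤ θ' k * ψ ((τ k b : ℤ) - (b : ℤ)) + α ((τ k b : ℤ) - (b : ℤ)) := by
        intro b
        have hb := hle_A k _ (displ_mem_Icc (τ k) b)
        have h1 : -|θ' k * ψ ((τ k b : ℤ) - (b : ℤ))| ≤ θ' k * ψ ((τ k b : ℤ) - (b : ℤ)) := neg_abs_le _
        have h2 : -|α ((τ k b : ℤ) - (b : ℤ))| ≤ α ((τ k b : ℤ) - (b : ℤ)) := neg_abs_le _
        linarith
      calc -(m * A) = ∑ _b : Fin m, (-A) := by
            rw [sum_const, card_univ, Fintype.card_fin]; simp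
        _ ≤ _ := sum_le_sum fun b _ => hterm' b
    have hmA : (0 : ℤ) ≤ m * A := by positivity
    rw [hM] at hσle
    linarith

end BigM

/-! ## The equivalences -/

/-- **The admissible set is inessential (fixed slope function)**: `FixedSlopeInstanceBound m ψ Φ ↔
FixedSlopeFreeInstanceBound m ψ Φ`. -/
theorem fixedSlopeInstanceBound_iff_free (m : ℕ) (ψ : ℤ → ℤ) (Φ : ℕ) :
    FixedSlopeInstanceBound m ψ Φ ↔ FixedSlopeFreeInstanceBound m ψ Φ := by
  constructor
  · intro h α N θ' τ hθ hτ hopt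
    exact h α (fun _ => True) N θ' τ hθ hτ (fun _ _ => trivial) (fun k σ' hσ' _ => hopt k σ' hσ')
  · intro h α P N θ' τ hθ hτ hP hopt
    obtain ⟨α', -, hopt'⟩ := exists_free_intercepts ψ α P N θ' τ hP hopt
    exact h α' N θ' τ hθ hτ hopt'

/-- **The admissible set is inessential**: `LinearInstanceBound m Φ ↔ FreeInstanceBound m Φ` — Conjecture T is the
plane-shadow count of ONE polytope per `m` (the displacement-profile polytope), no side family indexed by `P`. -/
theorem linearInstanceBound_iff_free (m Φ : ℕ) : LinearInstanceBound m Φ ↔ FreeInstanceBound m Φ := by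
  rw [linearInstanceBound_iff_fixedSlope, freeInstanceBound_iff_fixedSlope]
  exact forall_congr' fun ψ => fixedSlopeInstanceBound_iff_free m ψ Φ

/-- one direction by name: a free bound is a bound for every admissible set. -/
theorem LinearInstanceBound.of_free {m Φ : ℕ} (h : FreeInstanceBound m Φ) : LinearInstanceBound m Φ :=
  (linearInstanceBound_iff_free m Φ).mpr h

/-- the other direction by name. -/
theorem FreeInstanceBound.of_linear {m Φ : ℕ} (h : LinearInstanceBound m Φ) : FreeInstanceBound m Φ :=
  (linearInstanceBound_iff_free m Φ).mp h

/-- monotonicity in the bound. -/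
theorem FreeInstanceBound.mono {m Φ Φ' : ℕ} (h : FreeInstanceBound m Φ) (hle : Φ ≤ Φ') : FreeInstanceBound m Φ' :=
  fun ψ α N θ' τ hθ hτ hopt => le_trans (h ψ α N θ' τ hθ hτ hopt) hle

/-- `Φ_Toep` is non-decreasing, free form (corner pin `LinearInstanceBound.of_le`). -/
theorem FreeInstanceBound.of_le {m m' Φ : ℕ} (hmm' : m ≤ m') (h : FreeInstanceBound m' Φ) : FreeInstanceBound m Φ :=
  FreeInstanceBound.of_linear (LinearInstanceBound.of_le hmm' (LinearInstanceBound.of_free h))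

/-- **Conjecture T, free form**: `ConjectureTLinear ↔ ∃ C, ∀ m, FreeInstanceBound m (C·m)`. -/
theorem conjectureTLinear_iff_free : ConjectureTLinear ↔ ∃ C : ℕ, ∀ m : ℕ, FreeInstanceBound m (C * m) :=
  exists_congr fun C => forall_congr' fun m => linearInstanceBound_iff_free m (C * m)

/-- **Conjecture T_poly, free form**. -/
theorem conjectureTPoly_iff_free : ConjectureTPoly ↔ ∃ C : ℕ, ∀ m : ℕ, FreeInstanceBound m ((m + 1) ^ C) :=
  exists_congr fun C => forall_congr' fun m => linearInstanceBound_iff_free m ((m + 1) ^ C)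

/-- **Conjecture Q, free form** (`ψ = δ²`, no admissible set). -/
theorem conjectureQ_iff_free :
    ConjectureQ ↔ ∃ C : ℕ, ∀ m : ℕ, FixedSlopeFreeInstanceBound m (fun δ => δ ^ 2) (C * m) :=
  exists_congr fun C => forall_congr' fun m => fixedSlopeInstanceBound_iff_free m _ (C * m)

/-- the kernel floor `m ≤ Φ` in free form (`le_of_linearInstanceBound`, `…ToeplitzRotations` is not imported here; we use
the weaker non-vacuity `1 ≤ Φ` which needs no rotation instance). -/
theorem FreeInstanceBound.one_le {m Φ : ℕ} (h : FreeInstanceBound m Φ) : 1 ≤ Φ :=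
  LinearInstanceBound.one_le (LinearInstanceBound.of_free h)

end Summit.ValiantsHypothesis.ValiantsHypothesis.Theorems.KPlusLogSqLaw.Toeplitz
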